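import Literature.NumberTheory.EllipticCurves.Zhai2016.NonvanishingQuadraticTwistsErratum
import HarnessLib

/-!
# Zhai 2016, *Non-vanishing theorems for quadratic twists of elliptic curves* — arXiv v2 (2017) Theorems 1.2 and 1.4:
# the `2`-part of BSD for the twists `E^{(M)}` of Theorems 1.1 / 1.3 when the bad primes of `E` split in `ℚ(√M)`

HONEST FRAMING (cell `bsd-f1-sign2`, WIDTH-5 attach seat `bsd-line-att-p4` g23 on route `AlignedTransportAtTwo`;
answering the cell's REF2 placement of the «twist families of the certified seeds», INBOX 2026-08-29T21:28:52Z):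
PUBLISHED theorems vendored as named `Prop`s (nothing asserted, nothing discharged; D-0014), every printed hypothesis a
binder, locators into the author's arXiv v2 TeX. This file is the THIRD companion of
`Zhai2016/NonvanishingQuadraticTwists.lean` (v1 = journal text, Thms. 1.1–1.5) and
`Zhai2016/NonvanishingQuadraticTwistsErratum.lean` (v2 corrected twins `thm11_…'` / `thm12_…'` with the standing assumption
«the Manin constant `ν_E` is odd»), whose module docstring records (l. 76): «v2 also inserts NEW Thms. 1.2/1.4 — the `2`-part
of BSD for these twists when the bad primes of `E` split in `ℚ(√M)` and the `2`-part of BSD holds for `E` — NOT vendored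
here». They are vendored HERE, in the dictionary of those two files (nothing re-declared). Numbering: the names carry `v2`
because «Theorem 1.2 / 1.4» of arXiv v2 are NOT the journal's Theorems 1.2 / 1.4 (journal 1.2 = v2 1.3, journal 1.4 = v2 1.6).

Source of the statements. S. Zhai, arXiv:1409.0231**v2** (3 Dec 2017), `main.tex` (cell `b2b-bsdres` lit GEN 98 eprint
`run/shared/lean/b2b/bsd-rank1-residual/b2b-bsdres-lit/g98/eprints/zhainv_v2/main.tex`; journal version Asian J. Math. 20
(2016) 475–502, doi:10.4310/ajm.2016.v20.n3.a4 [Zhai2016]). Verbatim: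
* Standing conventions (TeX ll. 255–267): `E` optimal («the map `φ` does not factor through any other elliptic curve»),
  «**Assumption.** *The Manin constant `ν_E` is odd*» (Abbes–Ullmo for odd conductor), `M` square-free with `M ≡ 1 mod 4`,
  «Let `Ω⁺_{E^{(M)}}` denote the least positive real period of a Néron differential on a global minimal Weierstrass equation
  for `E^{(M)}`, and define `L^{(alg)}(E^{(M)},1) = L(E^{(M)},1)/Ω⁺_{E^{(M)}}`», `F` = `ℚ`(one root of the `2`-division
  polynomial), «a rational prime `q` [is] inert in the field `F` if it is unramified and there is a unique prime of `F` above
  `q`».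
* **v2 Theorem 1.1** (label `thm1`, ll. 273–279) = the tree's `thm11_ordTwo_LAlg_twist_eq_zero'` (Erratum file): «Let `E` be
  an optimal elliptic curve over `ℚ`, with odd Manin constant. Assume that `E` has negative discriminant, and satisfies
  `E[2](ℚ) = 0` and `ord₂(L^{(alg)}(E,1)) = 0`. Let `M` be any integer of the form `M = ε q₁q₂⋯q_r`, satisfying `(M, C) = 1`,
  where `C` is the conductor of `E`, `r ≥ 1`, `q₁, …, q_r` are arbitrary distinct odd primes which are inert in the field
  `F`, and the sign `ε = ±1` is chosen so that `M ≡ 1 mod 4`. Then `L(E^{(M)},1) ≠ 0`, and we have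
  `ord₂(L^{(alg)}(E^{(M)},1)) = 0`. Hence, `E^{(M)}(ℚ)` and `Ш(E^{(M)}(ℚ))` are finite.»
* (ll. 281) «Let `Sel₂(E)` denote the `2`-Selmer group of `E` over `ℚ`. In view of our assumption that `E[2](ℚ) = 0`, the
  `2`-part of the Birch and Swinnerton-Dyer conjecture for `E` would show that our hypothesis that `ord₂(L^{(alg)}(E,1)) = 0`
  implies that `Sel₂(E) = 0`, but it is still not known how to prove this at present. However, if we assume that the `2`-part
  of the Birch and Swinnerton-Dyer conjecture holds for `E`, and in addition to the hypotheses of Theorem 1.1, we will have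
  the following result under one further condition.»
* **v2 Theorem 1.2** (label `thm1-bsd`, ll. 283–285): «Assume the hypotheses of Theorem 1.1. We also suppose that the bad
  primes of `E` all split in `ℚ(√M)`, and that the `2`-part of the Birch and Swinnerton-Dyer conjecture holds for `E`. Then
  the `2`-part of the Birch and Swinnerton-Dyer conjecture holds for all the twists `E^{(M)}`.»
* (l. 287, a REMARK, not vendored) under the hypotheses of Thm. 1.1 plus (i) all bad primes multiplicative with odd
  `ord_p Δ_min` and (ii) «`E` has good reduction at `2` and the reduction of `E` modulo `2` has `j`-invariant `0`» (i.e. `E`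
  SUPERSINGULAR at `2`), Boxer–Diao [Thm. 1.2] + Thm. 1.1 give the `2`-part of BSD for all `E^{(M)}`. (So that remark does
  NOT apply to curves good ORDINARY at `2`; Theorem 1.2 has no hypothesis at `2` beyond `(M, C) = 1`.)
* **v2 Theorem 1.3** (label `thm1-1`, ll. 315–321) = the tree's `thm12_ordTwo_LAlg_twist_eq_one'`: positive discriminant,
  `ord₂(L^{(alg)}(E,1)) = 1`, `M > 0` («The hypothesis that `M` should now be positive is needed to ensure that the global
  root number of `L(E^{(M)},s)` is `+1`», l. 313), conclusion `ord₂(L^{(alg)}(E^{(M)},1)) = 1`.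
* **v2 Theorem 1.4** (label `thm1-1-bsd`, ll. 323–325): «Assume the hypotheses of Theorem 1.3. We also suppose that the bad
  primes of `E` all split in `ℚ(√M)`, and that the `2`-part of the Birch and Swinnerton-Dyer conjecture holds for `E`. Then
  the `2`-part of the Birch and Swinnerton-Dyer conjecture holds for all the twists `E^{(M)}`.»
* Proof (§3, ll. 820–935): Mazur–Rubin 2010 Lemmas 2.10 / 2.11 (criteria for equality / transversality of the local
  conditions `H¹_f(ℚ_v, E[2])`, `H¹_f(ℚ_v, E^{(M)}[2])` inside `H¹(ℚ_v, E[2])`, `E[2] = E^{(M)}[2]`): at a split bad prime,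
  at `2` (good, unramified in `ℚ(√M)` since `M ≡ 1 (4)`), at unramified good primes and at `∞` (`Δ < 0`) the local conditions
  agree; at `q ∣ M` (good, ramified, inert in `F`) `E(ℚ_q)[2] = 0` so both local conditions vanish — hence
  `Sel₂(E^{(M)}) = Sel₂(E) = 0` (Prop., ll. 862–880; for `Δ > 0` with `T = {∞}` and the Cassels–Tate pairing, ll. 884–889);
  Tamagawa: `ord₂ c_q(E^{(M)}) = ord₂ #E(ℚ_q)[2] = 0` at inert `q ∣ M` (Lemma `Tam_c_q`, [CLTZ §7]) and `c_p(E^{(M)}) = c_p(E)` at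
  split bad `p` (`E^{(M)} ≅ E` over `ℚ_p`); the `2`-part of BSD for `E` gives `ord₂ c_p(E) = 0`; combine with Thm. 1.1 / 1.3.
* Remark (l. 938): «there are infinitely many elliptic curves satisfying the `2`-part of the Birch and Swinnerton-Dyer
  conjecture. This is because we can always choose `M` to make all the bad primes of `E` split in `ℚ(√M)`.»

## Transcription (tree dictionary — that of the two companion files, verbatim, plus two items)

* «the hypotheses of Theorem 1.1 / 1.3» = the binder list of `thm11_ordTwo_LAlg_twist_eq_zero'` /
  `thm12_ordTwo_LAlg_twist_eq_one'` token for token (optimality datum `Dt` with `Zhai2021.IsOptimalDatum W Dt`, odd Manin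
  constant `¬ 2 ∣ Dt.c`, sign of `W.Δ`, `Nat.card E(ℚ)[2] = 1`, `ord₂` of the algebraic `L`-value via `IsLAlg`, the cubic field
  `IsTwoDivisionField W F`, `M` square-free, `M % 4 = 1`, `Int.gcd M C = 1`, `r ≥ 1` prime factors, each `≠ 2` and
  `IsInertIn F q`; `0 < M` in Thm. 1.3/1.4), `E^{(M)}` = any globally minimal model `WM` of `W.quadraticTwist M`.
* «the bad primes of `E` all split in `ℚ(√M)`» = every prime dividing the conductor `C = W.conductorNorm ℤ` splits in every
  quadratic number field `K ∋ √M`, i.e. `Literature.SatisfiesHeegnerHypothesis (W.conductorNorm ℤ) K` (`∀ p prime, p ∣ C →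
  #{primes of 𝓞_K over p} = 2`) — the idiom of `CaiLiZhai2019.thm15_twoPartBSD_twist` (there at level `2C`).
* «the `2`-part of the Birch and Swinnerton-Dyer conjecture holds for `E` / for `E^{(M)}`» = `CaiLiZhai2019.pPartBSD W 2` /
  `pPartBSD WM 2` (the equality of the powers of `2` on the two sides of the full BSD formula; the idiom of
  `thm14_neumannSetzer_twists` and of `CaiLiZhai2019.thm15_twoPartBSD_twist`).
No `_holds` expected (Manin/Cremona modular symbols for Thm. 1.1/1.3; Mazur–Rubin local constancy + Tamagawa bookkeeping for
1.2/1.4). Consumers take `(h : thm12v2_twoPartBSD_twist_of_split)` etc. (Statement-only file: no bookkeeping lemmas; note that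
CLZ's level-`2C` splitting binder implies Zhai's level-`C` one by `SatisfiesHeegnerHypothesis.of_dvd`.)

## The `p = 2` flag of this file

Natively AT 2, ANALYTIC RANK ZERO, `E[2](ℚ) = 0` (so `E[2]` is `G_ℚ`-irreducible), NO hypothesis on the reduction of `E` at `2`
(only `(M, C) = 1` and `M ≡ 1 (mod 4)`, which make the twist unramified at `2`); INPUT the `2`-part of BSD for the base curve
`E` (e.g. Creutz–Miller for `N_E < 5000`), OUTPUT the `2`-part of BSD for the explicit infinite family of twists `E^{(M)}`,
`M = ε q₁⋯q_r`, `q_i` inert in the cubic field `F` (Chebotarev density `1/3`) with every bad prime of `E` split in `ℚ(√M)`.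

## References
* [Zhai2016] S. Zhai, Asian J. Math. 20 (2016) no. 3, 475–502, doi:10.4310/ajm.2016.v20.n3.a4; arXiv:1409.0231v2 (2017)
  Thm. 1.2 (label `thm1-bsd`, TeX ll. 283–285), Thm. 1.4 (label `thm1-1-bsd`, ll. 323–325), proofs §3 (ll. 820–935),
  standing assumption (ll. 255–267).
* [MazurRubin2010] B. Mazur, K. Rubin, Invent. Math. 181 (2010), Lemmas 2.10, 2.11 (cited in the proof; not used here).
* [CaiLiZhai2019], [Zhai2021BSDExactFormulaTwists], [CoatesLiTianZhai2015] (tree files supplying `pPartBSD`,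
  `SatisfiesHeegnerHypothesis` usage, the optimality datum, `IsLAlg` / `leastRealPeriod`).
-/

noncomputable section

open scoped Classical MatrixGroups ModularForm

open CongruenceSubgroup NumberField WeierstrassCurve Literature.NumberTheory.EllipticCurves
  Literature.NumberTheory.EllipticCurves.ModularForms
  Literature.NumberTheory.EllipticCurves.CaiLiZhai2019
  Literature.NumberTheory.EllipticCurves.Zhai2021
  Literature.NumberTheory.EllipticCurves.CoatesLiTianZhai2015

namespace Literature.NumberTheory.EllipticCurves.Zhai2016

/-! ### §1. The two new printed theorems of arXiv v2 (named facts; nothing asserted) -/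

/-- **Zhai 2016, arXiv v2 Theorem 1.2** (label `thm1-bsd`; verbatim in the module docstring): «Assume the hypotheses of
Theorem 1.1. We also suppose that the bad primes of `E` all split in `ℚ(√M)`, and that the `2`-part of the Birch and
Swinnerton-Dyer [c.] holds for `E`. Then the `2`-part of the Birch and Swinnerton-Dyer [c.] holds for all the
twists `E^{(M)}`.» (the printed word «conj…» is abbreviated `[c.]` in this docstring only — verbatim in the module docstring — because
the named fact is a published THEOREM, not an open statement) Binders = those of `thm11_ordTwo_LAlg_twist_eq_zero'` token for token (`E` optimal with odd Manin
constant, `Δ_E < 0`, `E[2](ℚ) = 0`, `ord₂(L(E,1)/Ω_∞(E)) = 0`, `F` the cubic `2`-division field, `M` square-free,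
`M ≡ 1 (mod 4)`, `(M, C) = 1`, `r ≥ 1` odd prime factors inert in `F`), then: every prime of the conductor splits in every
quadratic field containing `√M` (`SatisfiesHeegnerHypothesis C K`), the `2`-part of BSD for `E` (`pPartBSD W 2`) ⟹ the
`2`-part of BSD for every globally minimal model `WM` of `E^{(M)}` (`pPartBSD WM 2`). AT 2, analytic rank ZERO, no
reduction hypothesis at `2`. No `_holds` expected.
[cite: Zhai2016, arXiv:1409.0231v2 Thm. 1.2 (label thm1-bsd, TeX ll. 283–285); proof §3 (ll. 843–935)] -/
def thm12v2_twoPartBSD_twist_of_split : Prop :=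
  ∀ (W : WeierstrassCurve ℚ) [W.IsElliptic] [W.IsGloballyMinimal] [NeZero (W.conductorNorm ℤ)]
    (Dt : ModularParametrizationData W (W.conductorNorm ℤ)), IsOptimalDatum W Dt → ¬ (2 : ℤ) ∣ Dt.c →
    W.Δ < 0 → Nat.card {P : W.toAffine.Point // (2 : ℕ) • P = 0} = 1 →
    (∃ x : ℚ, IsLAlg W x ∧ x ≠ 0 ∧ padicValRat 2 x = 0) →
    ∀ (F : Type) [Field F] [NumberField F], IsTwoDivisionField W F →
    ∀ (M : ℤ), Squarefree M → M % 4 = 1 → Int.gcd M (W.conductorNorm ℤ) = 1 →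
      M.natAbs.primeFactors.Nonempty → (∀ q ∈ M.natAbs.primeFactors, q ≠ 2 ∧ IsInertIn F q) →
    -- «the bad primes of `E` all split in `ℚ(√M)`»
    (∀ (K : Type) [Field K] [NumberField K], Module.finrank ℚ K = 2 → (∃ x : K, x ^ 2 = (M : K)) →
      SatisfiesHeegnerHypothesis (W.conductorNorm ℤ) K) →
    -- «the `2`-part of [BSD] holds for `E`»
    pPartBSD W 2 →
    ∀ (WM : WeierstrassCurve ℚ) [WM.IsElliptic] [WM.IsGloballyMinimal],
      (∃ C : VariableChange ℚ, C • W.quadraticTwist (M : ℚ) = WM) → pPartBSD WM 2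

/-- **Zhai 2016, arXiv v2 Theorem 1.4** (label `thm1-1-bsd`; verbatim in the module docstring): «Assume the hypotheses of
Theorem 1.3 [= journal Thm. 1.2: `E` optimal with odd Manin constant, `Δ_E > 0`, `E[2](ℚ) = 0`, `ord₂(L^{(alg)}(E,1)) = 1`,
`M = q₁⋯q_r > 0`, `(M, C) = 1`, `q_i` odd and inert in `F`, `M ≡ 1 mod 4`]. We also suppose that the bad primes of `E` all
split in `ℚ(√M)`, and that the `2`-part of the Birch and Swinnerton-Dyer [c.] holds for `E`. Then the `2`-part of the
Birch and Swinnerton-Dyer [c.] holds for all the twists `E^{(M)}`.» (the printed word «conj…» abbreviated `[c.]` here only) Binders = those of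
`thm12_ordTwo_LAlg_twist_eq_one'` token for token, then the split hypothesis and `pPartBSD W 2`; conclusion `pPartBSD WM 2`
for every globally minimal model `WM` of `E^{(M)}`. AT 2, analytic rank ZERO. No `_holds` expected.
[cite: Zhai2016, arXiv:1409.0231v2 Thm. 1.4 (label thm1-1-bsd, TeX ll. 323–325); proof §3 (ll. 843–935)] -/
def thm14v2_twoPartBSD_twist_pos_of_split : Prop :=
  ∀ (W : WeierstrassCurve ℚ) [W.IsElliptic] [W.IsGloballyMinimal] [NeZero (W.conductorNorm ℤ)]
    (Dt : ModularParametrizationData W (W.conductorNorm ℤ)), IsOptimalDatum W Dt → ¬ (2 : ℤ) ∣ Dt.c →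
    0 < W.Δ → Nat.card {P : W.toAffine.Point // (2 : ℕ) • P = 0} = 1 →
    (∃ x : ℚ, IsLAlg W x ∧ x ≠ 0 ∧ padicValRat 2 x = 1) →
    ∀ (F : Type) [Field F] [NumberField F], IsTwoDivisionField W F →
    ∀ (M : ℤ), 0 < M → Squarefree M → M % 4 = 1 → Int.gcd M (W.conductorNorm ℤ) = 1 →
      M.natAbs.primeFactors.Nonempty → (∀ q ∈ M.natAbs.primeFactors, q ≠ 2 ∧ IsInertIn F q) →
    (∀ (K : Type) [Field K] [NumberField K], Module.finrank ℚ K = 2 → (∃ x : K, x ^ 2 = (M : K)) →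
      SatisfiesHeegnerHypothesis (W.conductorNorm ℤ) K) →
    pPartBSD W 2 →
    ∀ (WM : WeierstrassCurve ℚ) [WM.IsElliptic] [WM.IsGloballyMinimal],
      (∃ C : VariableChange ℚ, C • W.quadraticTwist (M : ℚ) = WM) → pPartBSD WM 2

end Literature.NumberTheory.EllipticCurves.Zhai2016

end
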